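import Summits.RiemannHypothesis.RiemannHypothesis.Theses.Strip
import Literature.NumberTheory.BeurlingPrimes.RationalPrimes
import Literature.NumberTheory.BeurlingPrimes.WellBehavedIntegers
import Literature.NumberTheory.LFunctions.GeneralizedRH
import HarnessLib

/-!
# LINE «ARITHMETIC BEURLING TOWERS (shift dictionary)» — W-02 row 12 re-arm, rh-idea-2 g4, lens = transfer (Beurling dictionary)

Director-rh (BZ9) question Z1: **does SUPPORT ⊆ ℕ alone defeat the Beurling off-line towers?**
ANSWER RECORDED HERE (kernel part): NO for integer-NORMED g-prime systems (norms in ℕ, multiplicities allowed =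
Knopfmacher's «arithmetical semigroup with integer-valued norm»).  The explicit SHIFTED-DIVISOR SYSTEM `𝒫₂`:
for every rational prime `p` and `k ≥ 1` put `m_k(p)` g-primes of norm `p^{2k}`, `m₁(p) = p + 1`,
`m_k(p) = M_k(p)` (Moreau's necklace count) for `k ≥ 2`.  By the cyclotomic identity
`1/(1 − pY) = ∏_{k ≥ 1} (1 − Y^k)^{−M_k(p)}` (`Y = p^{−2s}`) its zeta function is
`ζ_{𝒫₂}(s) = ζ(2s)·ζ(2s − 1) = ∑_n σ(n) (n²)^{−s}`: the g-integers are the squares `n²` with multiplicity `σ(n)`,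
`N(x) = ∑_{n ≤ √x} σ(n) = (π²/12)·x − √x/2 + O(√x·log x)` (window `θ = 1/2 + ε`, and `θ = 1/2` is sharp: the jump at
`x = n²` is `σ(n) ≥ √x`), `ζ_{𝒫₂}` is meromorphic on `ℂ` (poles `s = 1, 1/2`) with the exact functional equation and
Euler product inherited from `ζ`, and ITS ZEROS IN `Re s > 1/2` ARE EXACTLY `(1 + ρ)/2`, `ρ` a non-trivial zero of
`ζ`: infinitely many ON `Re s = 3/4` unconditionally (Hardy 1914), all of them on `3/4` iff RH, none in
`1 − δ/2 < Re s < 1` iff `ζ` has the zero-free strip `1 − δ < Re s < 1`.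

So «support ⊆ ℕ + exact multiplicativity + integral coefficients + FE + finite-order continuation + power saving
θ > 1/2» is TOWER-BLIND: one arithmetic, unconditional, kernel-typable system carries an infinite tower at
`3/4 > θ`.  What it does NOT touch: multiplicity one / `θ < 1/2` (Ramanujan side; here multiplicities `≍ p`), and
ℚ-independence of `log`(norms) (here `log p², log p⁴` are dependent) — see the LINE card for the set-theoretic
clause (sub-multisets of ℙ: under RH the INTERMEDIATE system ℙ ∖ 𝒫_S of Broucke–Debruyne–Révész 2023 §5
(random deletion of ≈ Li(x^α) primes, 1/2 < α < 2/3) has a real zero at `s = α` above its integer window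
`2α/(α+2) + ε < 1/2` — a finite off-line tower with support ⊆ ℕ and multiplicity one (the final system of their
Thm 1.3 = tree `BrouckeDebruyneRevesz2023_thm13` adjoins NON-integer `p^{1/β}`); unconditionally: deterministic
greedy prime surgery plants zeros AT the window edge only; strictly inside the window, and any infinite tower for a
subset of ℙ, is OPEN in print = Knopfmacher 1975 Appendix problem 11 in its weak form).  LINE L61 (director-rh (CA7)).

CONTENTS.  §1 the objects (`shiftZeta`, `necklace`, `shiftMult`, `shiftWeight`, `IsShiftSystem`); §2 three PORT
OBLIGATIONS typed as Props (K1 `ShiftSystemExists`, K2 `ShiftSystemZeta`, K3 `ShiftSystemCount`; elementary,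
RH-free, provable — NOT cruxes) and the support identity P1 `NecklaceIdentity`; §3 KERNEL THEOREMS (no sorry,
no obligation): the zeros of `shiftZeta` right of `1/2`, the infinite tower on `3/4` (Hardy), `RH ↔ tower capped
at 3/4` (two forms), continuation; §4 the DICTIONARY THEOREMS: K1 → K2 → K3 → `IntegerTowerModel θ (3/4)` for
every `θ > 1/2` (unconditional), `… → RH → IntegerCappedTowerModel θ (3/4)`, `… → StripZeroFreeStrip →
IntegerCappedTowerModelStrip θ` (= the g3 shape `CappedTowerModel θ` of LINE L56 realised with INTEGER norms).
This file has NO `sorry`.  CATEGORY: (s)/(b) barrier record; 0 toward RH.  Nothing here bears on the truth of RH.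
No summit is proved by a line.
-/

noncomputable section

set_option linter.dupNamespace false

namespace Summit.RiemannHypothesis.RiemannHypothesis.Theorems.ArithmeticBeurlingTowers

open Complex Literature.Barriers.RiemannHypothesis Literature.NumberTheory.BeurlingPrimes
open Literature.NumberTheory.LFunctions
open Summit.RiemannHypothesis.RiemannHypothesis.Theses.Strip (StripZeroFreeStrip)

/-! ### §1 Objects -/

/-- The zeta function of the shifted-divisor system: `Z₂(s) = ζ(2s)·ζ(2s − 1)`. -/
def shiftZeta (s : ℂ) : ℂ := riemannZeta (2 * s) * riemannZeta (2 * s - 1)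

/-- Moreau's necklace count `M_k(y) = (1/k) ∑_{d ∣ k} μ(d) y^{k/d}` (an integer; number of aperiodic necklaces /
Lyndon words of length `k` over `y` letters). -/
def necklace (k y : ℕ) : ℤ :=
  (∑ d ∈ k.divisors, (ArithmeticFunction.moebius d : ℤ) * (y : ℤ) ^ (k / d)) / (k : ℤ)

/-- Multiplicity of g-primes of norm `p^{2k}` in the shifted-divisor system: `p + 1` for `k = 1`, `M_k(p)` for
`k ≥ 2` (the exponents in `1/((1 − Y)(1 − pY)) = ∏_k (1 − Y^k)^{−m_k(p)}`). -/
def shiftMult (p k : ℕ) : ℤ := if k = 1 then (p : ℤ) + 1 else necklace k p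

/-- Total multiplicity of the norm `n` among the g-primes: `shiftMult p k` if `n = p^{2k}` (`p` prime, `k ≥ 1`),
else `0`. -/
def shiftWeight (n : ℕ) : ℤ :=
  ∑ p ∈ (Finset.range (n + 1)).filter Nat.Prime,
    ∑ k ∈ Finset.range (n + 1), if 0 < k ∧ p ^ (2 * k) = n then shiftMult p k else 0

/-- `P` IS the shifted-divisor system: every g-prime has a natural-number norm, and the norm `n` occurs exactly
`shiftWeight n` times. (Determines `P` up to re-indexing inside equal norms.) -/
def IsShiftSystem (P : BeurlingPrimes) : Prop :=
  (∀ j : ℕ, ∃ n : ℕ, P.prime j = n) ∧ ∀ n : ℕ, (Nat.card {j : ℕ // P.prime j = n} : ℤ) = shiftWeight n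

/-! ### §2 Port obligations (typed, elementary, RH-free; ★ tasks, not cruxes) and the support identity -/

/-- **K1 (★ port).** The shifted-divisor system exists as a `BeurlingPrimes` enumeration (monotone enumeration of a
locally finite multiset of integers `≥ 4` with non-negative multiplicities `shiftWeight`). -/
def ShiftSystemExists : Prop := ∃ P : BeurlingPrimes, IsShiftSystem P

/-- **K2 (★ port).** Its zeta function is `ζ(2s)ζ(2s − 1)` on `Re s > 1` (Euler product `hasProd_zeta` + the
cyclotomic/necklace identity `NecklaceIdentity`). -/
def ShiftSystemZeta : Prop :=
  ∀ P : BeurlingPrimes, IsShiftSystem P → ∀ s : ℂ, 1 < s.re → P.zeta s = shiftZeta s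

/-- **K3 (★ port).** Its integer counting function satisfies `N(x) = (π²/12)x + O(x^θ)` for every `θ > 1/2`
(`N(x) = ∑_{n ≤ √x} σ(n)`; Dirichlet's hyperbola method). -/
def ShiftSystemCount : Prop :=
  ∀ P : BeurlingPrimes, IsShiftSystem P → ∀ θ : ℝ, 1 / 2 < θ → P.IntErrorLE (Real.pi ^ 2 / 12) θ

/-- **P1 (support).** Moreau's identity `∑_{d ∣ k} d·M_d(y) = y^k` and `M_k(y) ≥ 0`. -/
def NecklaceIdentity : Prop :=
  ∀ y k : ℕ, 0 < k → (∑ d ∈ k.divisors, (d : ℤ) * necklace d y) = (y : ℤ) ^ k ∧ 0 ≤ necklace k y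

/-! ### The director's question as Props (integer-normed systems) -/

/-- «Support ⊆ ℕ does NOT defeat towers» at window `θ`, abscissa `Θ`: an integer-normed discrete g-prime system with
`|N(x) − ax| ≤ C x^θ` (`a > 0`) whose zeta function continues to `{Re s > θ} ∖ {1}` and has infinitely many zeros
on `Re s = Θ`. -/
def IntegerTowerModel (θ Θ : ℝ) : Prop :=
  ∃ (P : BeurlingPrimes) (a : ℝ) (Z : ℂ → ℂ), 0 < a ∧ (∀ j : ℕ, ∃ n : ℕ, P.prime j = n) ∧
    P.IntErrorLE a θ ∧ P.IsZetaContinuation θ Z ∧ {s : ℂ | Z s = 0 ∧ s.re = Θ}.Infinite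

/-- The same with the tower CAPPED at `Θ`: no zero of the continuation with `Re s > Θ`. -/
def IntegerCappedTowerModel (θ Θ : ℝ) : Prop :=
  ∃ (P : BeurlingPrimes) (a : ℝ) (Z : ℂ → ℂ), 0 < a ∧ (∀ j : ℕ, ∃ n : ℕ, P.prime j = n) ∧
    P.IntErrorLE a θ ∧ P.IsZetaContinuation θ Z ∧ (∀ s : ℂ, Θ < s.re → s ≠ 1 → Z s ≠ 0) ∧
    {s : ℂ | Z s = 0 ∧ s.re = Θ}.Infinite

/-- The g3 shape `CappedTowerModel θ` of LINE L56 (zero-free strip `1 − δ < Re s < 1` + infinitely many zeros with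
`Re s ≥ 1/2 + ε`), with the extra clause «integer norms». -/
def IntegerCappedTowerModelStrip (θ : ℝ) : Prop :=
  ∃ (P : BeurlingPrimes) (a : ℝ) (Z : ℂ → ℂ), 0 < a ∧ (∀ j : ℕ, ∃ n : ℕ, P.prime j = n) ∧
    P.IntErrorLE a θ ∧ P.IsZetaContinuation θ Z ∧
    (∃ δ : ℝ, 0 < δ ∧ ∀ s : ℂ, 1 - δ < s.re → s.re < 1 → Z s ≠ 0) ∧
    ∃ ε : ℝ, 0 < ε ∧ {s : ℂ | Z s = 0 ∧ 1 / 2 + ε ≤ s.re ∧ s.re < 1}.Infinite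

/-! ### §3 Kernel theorems on `shiftZeta` (no obligation, no sorry) -/

/-- `Re (2s) = 2 Re s`. -/
theorem re_two_mul (s : ℂ) : ((2 : ℂ) * s).re = 2 * s.re := by simp [Complex.mul_re]

/-- `Re (2s − 1) = 2 Re s − 1`. -/
theorem re_two_mul_sub_one (s : ℂ) : ((2 : ℂ) * s - 1).re = 2 * s.re - 1 := by simp [Complex.mul_re]

/-- Right of `Re s = 1/2` the factor `ζ(2s)` does not vanish, so the zeros of `Z₂` there are those of `ζ(2s − 1)`. -/
theorem shiftZeta_eq_zero_iff {s : ℂ} (hs : 1 / 2 < s.re) : shiftZeta s = 0 ↔ riemannZeta (2 * s - 1) = 0 := by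
  have h2 : riemannZeta (2 * s) ≠ 0 := riemannZeta_ne_zero_of_one_le_re (by rw [re_two_mul]; linarith)
  simp [shiftZeta, mul_eq_zero, h2]

/-- Every zero of `Z₂` right of `1/2` has `1/2 < Re s < 1` (it is `(1 + ρ)/2` with `ζ ρ = 0`, `0 < Re ρ < 1`). -/
theorem re_lt_one_of_shiftZeta_eq_zero {s : ℂ} (h0 : shiftZeta s = 0) (hs : 1 / 2 < s.re) : s.re < 1 := by
  have hz := (shiftZeta_eq_zero_iff hs).1 h0
  by_contra h
  exact riemannZeta_ne_zero_of_one_le_re (by rw [re_two_mul_sub_one]; linarith) hz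

/-- **The tower.** `Z₂` has infinitely many zeros ON the line `Re s = 3/4` (Hardy 1914, in-tree
`hardy_infinite_zeros_on_critical_line_holds`, transported by `t ↦ 3/4 + it/2`). -/
theorem shiftZeta_tower_infinite : {s : ℂ | shiftZeta s = 0 ∧ s.re = 3 / 4}.Infinite := by
  have hH : {t : ℝ | riemannZeta (1 / 2 + t * I) = 0}.Infinite := hardy_infinite_zeros_on_critical_line_holds
  let f : ℝ → ℂ := fun t ↦ ⟨3 / 4, t / 2⟩
  have hf : Set.InjOn f {t : ℝ | riemannZeta (1 / 2 + t * I) = 0} := by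
    intro t₁ _ t₂ _ h
    have := congrArg Complex.im h
    simp only [f] at this
    linarith
  refine (hH.image hf).mono ?_
  rintro _ ⟨t, ht, rfl⟩
  have h2 : 2 * (f t) - 1 = 1 / 2 + t * I := by
    apply Complex.ext <;> simp [f] <;> ring
  refine ⟨?_, rfl⟩
  simp only [Set.mem_setOf_eq] at ht
  show riemannZeta (2 * f t) * riemannZeta (2 * f t - 1) = 0
  rw [h2, ht, mul_zero]

/-- **RH ⟺ the tower of `Z₂` sits exactly on `3/4`.** -/
theorem rh_iff_shiftZeta_zeros_on_three_quarters :
    RiemannHypothesis ↔ ∀ s : ℂ, shiftZeta s = 0 → 1 / 2 < s.re → s.re = 3 / 4 := by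
  constructor
  · intro hRH s h0 hs
    have hz := (shiftZeta_eq_zero_iff hs).1 h0
    have hntriv : ¬ ∃ n : ℕ, 2 * s - 1 = -2 * (n + 1) := by
      rintro ⟨n, hn⟩
      have := congrArg Complex.re hn
      rw [re_two_mul_sub_one] at this
      simp [Complex.mul_re] at this
      have hn0 : (0 : ℝ) ≤ n := n.cast_nonneg
      linarith
    have hne1 : 2 * s - 1 ≠ 1 := by
      intro h; rw [h] at hz; exact riemannZeta_one_ne_zero hz
    have := hRH (2 * s - 1) hz hntriv hne1
    rw [re_two_mul_sub_one] at this
    linarith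
  · intro hT ρ hζ hntriv hne1
    have hpos : 0 < ρ.re := by
      by_contra h
      exact hntriv ((riemannZeta_eq_zero_iff_of_re_nonpos (not_lt.1 h)).1 hζ)
    let s : ℂ := ⟨(1 + ρ.re) / 2, ρ.im / 2⟩
    have h2 : 2 * s - 1 = ρ := by
      apply Complex.ext <;> simp [s] <;> ring
    have h0 : shiftZeta s = 0 := by simp [shiftZeta, h2, hζ]
    have := hT s h0 (by show 1 / 2 < (1 + ρ.re) / 2; linarith)
    change (1 + ρ.re) / 2 = 3 / 4 at this
    linarith

/-- Reflection `ρ ↦ 1 − ρ` of zeros of `ζ` in `Re s > 0`, `s ≠ 1` (functional equation, Mathlib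
`riemannZeta_one_sub`). -/
theorem riemannZeta_one_sub_eq_zero {s : ℂ} (h0 : 0 < s.re) (h1 : s ≠ 1) (hz : riemannZeta s = 0) :
    riemannZeta (1 - s) = 0 := by
  have hs : ∀ n : ℕ, s ≠ -(n : ℂ) := by
    intro n hn
    have : s.re = -(n : ℝ) := by rw [hn]; simp
    have hn0 : (0 : ℝ) ≤ n := Nat.cast_nonneg n
    linarith
  rw [riemannZeta_one_sub hs h1, hz, mul_zero]

/-- **RH ⟺ the tower of `Z₂` is CAPPED at `3/4`** (no zero with `Re s > 3/4`; zeros in `(1/2, 3/4)` are then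
excluded by the reflection `ρ ↦ 1 − ρ`). -/
theorem rh_iff_shiftZeta_capped :
    RiemannHypothesis ↔ ∀ s : ℂ, shiftZeta s = 0 → 1 / 2 < s.re → s.re ≤ 3 / 4 := by
  constructor
  · intro hRH s h0 hs
    exact (rh_iff_shiftZeta_zeros_on_three_quarters.1 hRH s h0 hs).le
  · intro hT
    refine rh_iff_shiftZeta_zeros_on_three_quarters.2 fun s h0 hs ↦ le_antisymm (hT s h0 hs) ?_
    -- reflect: ρ = 2s − 1 ↦ 1 − ρ = 2s' − 1 with s' = 1 − s + 1/2... concretely s' := 3/2 − s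
    have hz := (shiftZeta_eq_zero_iff hs).1 h0
    have hlt := re_lt_one_of_shiftZeta_eq_zero h0 hs
    have hρ0 : 0 < (2 * s - 1).re := by rw [re_two_mul_sub_one]; linarith
    have hρ1 : 2 * s - 1 ≠ 1 := by
      intro h; rw [h] at hz; exact riemannZeta_one_ne_zero hz
    have hz' : riemannZeta (1 - (2 * s - 1)) = 0 := riemannZeta_one_sub_eq_zero hρ0 hρ1 hz
    let s' : ℂ := 3 / 2 - s
    have hs' : (1 : ℂ) - (2 * s - 1) = 2 * s' - 1 := by simp only [s']; ring
    have hre' : s'.re = 3 / 2 - s.re := by simp [s']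
    have hs'half : 1 / 2 < s'.re := by rw [hre']; linarith
    have h0' : shiftZeta s' = 0 := (shiftZeta_eq_zero_iff hs'half).2 (hs' ▸ hz')
    have := hT s' h0' hs'half
    rw [hre'] at this
    linarith

/-- Under RH, `Z₂` has no zero with `Re s > 3/4`. -/
theorem shiftZeta_ne_zero_of_rh (hRH : RiemannHypothesis) {s : ℂ} (hs : 3 / 4 < s.re) : shiftZeta s ≠ 0 :=
  fun h0 ↦ by
    have := rh_iff_shiftZeta_zeros_on_three_quarters.1 hRH s h0 (by linarith)
    linarith

/-- A zero-free strip `1 − δ < Re s < 1` for `ζ` (route item `Strip.StripZeroFreeStrip`) is a zero-free strip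
`1 − min δ 1 / 2 < Re s < 1` for `Z₂`. -/
theorem shiftZeta_strip (hS : StripZeroFreeStrip) :
    ∃ δ : ℝ, 0 < δ ∧ ∀ s : ℂ, 1 - δ < s.re → s.re < 1 → shiftZeta s ≠ 0 := by
  obtain ⟨δ, hδ, hfree⟩ := hS
  refine ⟨min δ 1 / 2, by have := lt_min hδ one_pos; linarith, fun s h1 h2 h0 ↦ ?_⟩
  have hm1 : min δ 1 ≤ 1 := min_le_right _ _
  have hmδ : min δ 1 ≤ δ := min_le_left _ _
  have hs : 1 / 2 < s.re := by linarith
  have hz := (shiftZeta_eq_zero_iff hs).1 h0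
  exact hfree (2 * s - 1) hz (by rw [re_two_mul_sub_one]; linarith) (by rw [re_two_mul_sub_one]; linarith)

/-- `Z₂` is complex-differentiable on `{Re s > 1/2} ∖ {1}`. -/
theorem differentiableAt_shiftZeta {s : ℂ} (hs : 1 / 2 < s.re) (hs1 : s ≠ 1) :
    DifferentiableAt ℂ shiftZeta s := by
  have h2 : (2 : ℂ) * s ≠ 1 := by
    intro h
    have := congrArg Complex.re h
    rw [re_two_mul] at this
    simp at this
    linarith
  have h3 : (2 : ℂ) * s - 1 ≠ 1 := by
    intro h
    apply hs1
    linear_combination h / 2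
  have d1 : DifferentiableAt ℂ (fun z : ℂ ↦ riemannZeta (2 * z)) s :=
    (differentiableAt_riemannZeta h2).comp s (by fun_prop)
  have d2 : DifferentiableAt ℂ (fun z : ℂ ↦ riemannZeta (2 * z - 1)) s :=
    (differentiableAt_riemannZeta h3).comp s (by fun_prop)
  exact d1.mul d2

/-- If `ζ_P = Z₂` on `Re s > 1`, then `Z₂` is a zeta continuation of `P` to every half-plane `Re s > β`, `β ≥ 1/2`. -/
theorem isZetaContinuation_shiftZeta {P : BeurlingPrimes} (hζ : ∀ s : ℂ, 1 < s.re → P.zeta s = shiftZeta s)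
    {β : ℝ} (hβ : 1 / 2 ≤ β) : P.IsZetaContinuation β shiftZeta :=
  ⟨fun s hs ↦ (hζ s hs).symm,
    fun _ hs ↦ (differentiableAt_shiftZeta (lt_of_le_of_lt hβ hs.1) hs.2).differentiableWithinAt⟩

/-! ### §4 Dictionary theorems: the obligations imply the tower models -/

/-- **Z1 answered for integer-NORMED systems (unconditional modulo the ports K1–K3):** for every window `θ > 1/2`
there is an integer-normed g-prime system with `N(x) = (π²/12)x + O(x^θ)` whose zeta function continues to
`{Re s > θ} ∖ {1}` with INFINITELY MANY ZEROS ON `Re s = 3/4`. -/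
theorem integerTowerModel_of_shift (h1 : ShiftSystemExists) (h2 : ShiftSystemZeta) (h3 : ShiftSystemCount) :
    ∀ θ : ℝ, 1 / 2 < θ → IntegerTowerModel θ (3 / 4) := by
  intro θ hθ
  obtain ⟨P, hP⟩ := h1
  exact ⟨P, Real.pi ^ 2 / 12, shiftZeta, by positivity, hP.1, h3 P hP θ hθ,
    isZetaContinuation_shiftZeta (h2 P hP) hθ.le, shiftZeta_tower_infinite⟩

/-- Under RH the tower is capped at `3/4` (and conversely a cap at `3/4` for `Z₂` is RH: `rh_iff_shiftZeta_capped`). -/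
theorem integerCappedTowerModel_of_shift_of_rh (h1 : ShiftSystemExists) (h2 : ShiftSystemZeta)
    (h3 : ShiftSystemCount) (hRH : RiemannHypothesis) :
    ∀ θ : ℝ, 1 / 2 < θ → IntegerCappedTowerModel θ (3 / 4) := by
  intro θ hθ
  obtain ⟨P, hP⟩ := h1
  exact ⟨P, Real.pi ^ 2 / 12, shiftZeta, by positivity, hP.1, h3 P hP θ hθ,
    isZetaContinuation_shiftZeta (h2 P hP) hθ.le, fun s hs _ ↦ shiftZeta_ne_zero_of_rh hRH hs,
    shiftZeta_tower_infinite⟩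

/-- Given the zero-free strip for `ζ` (item `Strip.StripZeroFreeStrip`, stmt-RiemannHypothesis-10660), the
shifted-divisor system is a g3-shape capped-tower model WITH INTEGER NORMS in every window `θ > 1/2`: the L56
negative `¬ IntegerTooth θ` (`θ > 1/2`) survives the restriction to integer-normed systems. -/
theorem integerCappedTowerModelStrip_of_shift (h1 : ShiftSystemExists) (h2 : ShiftSystemZeta)
    (h3 : ShiftSystemCount) (hS : StripZeroFreeStrip) :
    ∀ θ : ℝ, 1 / 2 < θ → IntegerCappedTowerModelStrip θ := by
  intro θ hθ
  obtain ⟨P, hP⟩ := h1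
  refine ⟨P, Real.pi ^ 2 / 12, shiftZeta, by positivity, hP.1, h3 P hP θ hθ,
    isZetaContinuation_shiftZeta (h2 P hP) hθ.le, shiftZeta_strip hS, 1 / 4, by norm_num, ?_⟩
  refine shiftZeta_tower_infinite.mono ?_
  rintro s ⟨h0, hre⟩
  exact ⟨h0, by rw [hre]; norm_num, by rw [hre]; norm_num⟩

end Summit.RiemannHypothesis.RiemannHypothesis.Theorems.ArithmeticBeurlingTowers

end
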